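import Mathlib.RepresentationTheory.Irreducible
import Mathlib.RingTheory.SimpleModule.Isotypic
import Mathlib.LinearAlgebra.TensorProduct.Basis
import Mathlib.LinearAlgebra.DirectSum.Finsupp
import Mathlib.RingTheory.Flat.Basic
import HarnessLib

/-!
# The evaluation map `S ⊗ Hom_A(S, M) → M` of a simple module `S` with scalar commutant: injective always,
# bijective onto an `S`-isotypic `M` (isotypic calculus); representation-theoretic dictionary

Topic `RepresentationTheory`; namespace `Literature.RepresentationTheory`.  THEOREMS ONLY (no definition, no named fact,
no instance): the evaluation map is not introduced as a constant; every statement is about an arbitrary `k`-linear map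
`ev` with `ev (s ⊗ f) = f s` (such a map exists and is unique, `TensorProduct.lift`), and the main result is the
EXISTENCE of a `k`-linear equivalence with that formula.

§1 (modules). Let `k` be a field, `A` a `k`-algebra, `S` a SIMPLE `A`-module whose commutant is the scalars
(`∀ φ ∈ End_A(S), ∃ c : k, φ = c • id` — Schur's lemma in scalar form, e.g. `k` algebraically closed and `S`
finite-dimensional, or an irreducible admissible representation), `M` any `A`-module, `Hom_A(S, M) = S →ₗ[A] M` (a `k`-space).
* `sum_eq_zero_of_linearIndependent` — **linear disjointness**: if `(f_β)` is `k`-linearly independent in `Hom_A(S, M)` and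
  `∑_β f_β(s_β) = 0` for a finitely supported family `(s_β)` in `S`, then every `s_β = 0` (the relation module
  `{(s_β) | ∑ f_β s_β = 0} ≤ ⊕_β S` is a submodule of a semisimple `S`-isotypic module; a simple submodule of it is a copy of
  `S` embedded by scalar coordinates `c_β` (Schur), forcing `∑ c_β f_β = 0`).
* `injective_of_forall_apply_tmul` — hence every `ev : S ⊗[k] Hom_A(S, M) → M` with `ev (s ⊗ f) = f s` is INJECTIVE
  (no hypothesis on `M`).
* `surjective_of_forall_apply_tmul` — if `M` is its own `S`-isotypic component (Mathlib `isotypicComponent A M S = ⊤`: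
  `M` is a sum of copies of `S`), `ev` is SURJECTIVE (no Schur hypothesis).
* `exists_linearEquiv_apply_tmul` — under both hypotheses `∃ e : S ⊗[k] Hom_A(S, M) ≃ₗ[k] M, e (s ⊗ f) = f s`: the
  isotypic calculus `M ≅ S ⊗ Hom_A(S, M)` (Bourbaki, *Algèbre* VIII §4 n°4; Bump 1997, proof of Prop. 3.4.1–3.4.2,
  `λ(m ⊗ n) = n(m)`; Flath 1979, proof of Thm. 1).
§2 (representations). The same four statements for a group `G`, an irreducible `τ : G → GL(T)` with scalar commutant and
any `π : G → GL(W)`, with `Hom_G(τ, π)` = Mathlib's `τ.IntertwiningMap π` and the isotypy hypothesis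
`isotypicComponent k[G] π.asModule τ.asModule = ⊤` (transport along `IntertwiningMap.equivLinearMapAsModule`).
The `G`-equivariance of the equivalence (`τ ⊗ 1`) and its equivariance for operators commuting with `π(G)` acting by
post-composition are immediate from the formula `e (t ⊗ f) = f t` and are left to the users.

## References
* N. Bourbaki, *Algèbre*, Ch. VIII (2012 ed.), §4 n°4 Prop. 2, §7 n°7.
* D. Bump, *Automorphic Forms and Representations* (1997), §3.4, Prop. 3.4.1, Prop. 3.4.2 (PDF p. 302).
* D. Flath, *Decomposition of representations into tensor products*, PSPM 33.1 (1979), Thm. 1 and its proof.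
-/

set_option autoImplicit false

noncomputable section

open TensorProduct

namespace Literature.RepresentationTheory

universe u

/-! ## §1 Simple modules with scalar commutant over a `k`-algebra -/

section Module

variable {k : Type*} [Field k] {A : Type*} [Ring A] [Algebra k A]
variable {S M : Type*} [AddCommGroup S] [Module A S] [Module k S] [IsScalarTower k A S]
  [AddCommGroup M] [Module A M] [Module k M] [IsScalarTower k A M]

/-- **Linear disjointness of `S` and `Hom_A(S, M)`.**  For a simple `A`-module `S` with scalar commutant, a `k`-linearly
independent family `(f_β)` in `Hom_A(S, M)` and a finitely supported family `(s_β)` in `S` with `∑_β f_β (s_β) = 0`, every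
`s_β` vanishes.  (Bump 1997, proof of Prop. 3.4.1: the relation module is a submodule of the semisimple isotypic `⊕_β S`,
so if non-zero it contains a copy of `S`, embedded by scalar coordinates by Schur.) [cite: Bump1997, Prop. 3.4.1] -/
theorem sum_eq_zero_of_linearIndependent [IsSimpleModule A S]
    (hS : ∀ φ : S →ₗ[A] S, ∃ c : k, ∀ x, φ x = c • x)
    {B : Type*} {f : B → (S →ₗ[A] M)} (hf : LinearIndependent k f)
    (t : B →₀ S) (ht : (t.sum fun β x => f β x) = 0) : t = 0 := by
  classical
  let L : (B →₀ S) →ₗ[A] M := Finsupp.lsum ℕ f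
  have hL : ∀ s : B →₀ S, L s = s.sum fun β x => f β x := fun s => by
    simp only [L, Finsupp.lsum_apply]
  have ht' : t ∈ LinearMap.ker L := by rw [LinearMap.mem_ker, hL]; exact ht
  by_contra hne
  -- the relation module is a non-zero submodule of the semisimple module `⊕_β S`: it contains a simple submodule `m`
  have hZ : LinearMap.ker L ≠ ⊥ := fun h => hne (by simpa [h] using ht')
  obtain ⟨m, hmZ, hm⟩ := (IsSemisimpleModule.eq_bot_or_exists_simple_le (LinearMap.ker L)).resolve_left hZ
  -- some coordinate projection is non-zero on `m`, hence an isomorphism `m ≅ S`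
  obtain ⟨z, hzm, hz0⟩ :=
    (Submodule.ne_bot_iff m).1 (Submodule.nontrivial_iff_ne_bot.1 (IsSimpleModule.nontrivial A m))
  obtain ⟨β₀, hβ₀⟩ : ∃ β, z β ≠ 0 := by
    by_contra h
    push Not at h
    exact hz0 (Finsupp.ext h)
  let p : m →ₗ[A] S := (Finsupp.lapply β₀).comp m.subtype
  have hp : Function.Bijective p := by
    refine (LinearMap.bijective_or_eq_zero p).resolve_right fun h => hβ₀ ?_
    simpa [p] using LinearMap.congr_fun h ⟨z, hzm⟩
  let e : S ≃ₗ[A] m := (LinearEquiv.ofBijective p hp).symm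
  -- the embedding `φ : S → Z ≤ ⊕_β S` and its scalar coordinates (Schur)
  let φ : S →ₗ[A] (B →₀ S) := m.subtype.comp e.toLinearMap
  have hφZ : ∀ x, φ x ∈ LinearMap.ker L := fun x => hmZ (e x).2
  have hφinj : Function.Injective φ := m.subtype_injective.comp e.injective
  have hcoord : ∀ β, ∃ c : k, ∀ x : S, φ x β = c • x := fun β => hS ((Finsupp.lapply β).comp φ)
  choose c hc using hcoord
  -- only finitely many coordinates are non-zero: those in the support of `φ x₀` for a fixed `x₀ ≠ 0`
  haveI : Nontrivial S := IsSimpleModule.nontrivial A S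
  obtain ⟨x₀, hx₀⟩ := exists_ne (0 : S)
  have hcsupp : ∀ β, c β ≠ 0 → β ∈ (φ x₀).support := fun β hcβ => by
    rw [Finsupp.mem_support_iff, hc β x₀]
    exact smul_ne_zero hcβ hx₀
  -- the relation `∑_β c_β • f_β = 0` in `Hom_A(S, M)`
  have hrel : ∀ x : S, (∑ β ∈ (φ x₀).support, c β • f β x) = 0 := fun x => by
    have h1 : L (φ x) = 0 := hφZ x
    have h2 : ((φ x).sum fun β y => f β y) = ∑ β ∈ (φ x₀).support, f β (φ x β) := by
      refine Finsupp.sum_of_support_subset _ (fun β hβ => ?_) _ (fun β _ => by simp)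
      rw [Finsupp.mem_support_iff, hc β x] at hβ
      exact hcsupp β (by rintro h0; exact hβ (by rw [h0, zero_smul]))
    rw [hL, h2] at h1
    simpa only [hc, LinearMap.map_smul_of_tower] using h1
  have hlin : ∑ β ∈ (φ x₀).support, c β • f β = 0 := by
    apply LinearMap.ext
    intro x
    simpa [LinearMap.sum_apply] using hrel x
  -- linear independence kills every `c β` on that support, hence `φ x₀ = 0`: contradiction with injectivity
  have hc0 : ∀ β ∈ (φ x₀).support, c β = 0 :=
    fun β hβ => linearIndependent_iff'.1 hf (φ x₀).support c hlin β hβ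
  have hzero : φ x₀ = 0 := by
    apply Finsupp.ext
    intro β
    by_cases hβ : β ∈ (φ x₀).support
    · rw [hc β x₀, hc0 β hβ, zero_smul, Finsupp.zero_apply]
    · exact Finsupp.notMem_support_iff.1 hβ
  exact hx₀ (hφinj (by rw [hzero, map_zero]))

/-- **The evaluation map `S ⊗_k Hom_A(S, M) → M` is injective** for a simple `S` with scalar commutant and ANY `A`-module
`M`.  Stated for every `k`-linear `ev` with `ev (s ⊗ f) = f s`. [cite: Bump1997, Prop. 3.4.1] -/
theorem injective_of_forall_apply_tmul [IsSimpleModule A S]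
    (hS : ∀ φ : S →ₗ[A] S, ∃ c : k, ∀ x, φ x = c • x)
    (ev : S ⊗[k] (S →ₗ[A] M) →ₗ[k] M) (hev : ∀ (s : S) (f : S →ₗ[A] M), ev (s ⊗ₜ[k] f) = f s) :
    Function.Injective ev := by
  classical
  -- expand along a `k`-basis `b` of `Hom_A(S, M)`: `Φ t = ∑_β t_β ⊗ b_β` is onto `S ⊗ Hom`
  let b := Module.Free.chooseBasis k (S →ₗ[A] M)
  let B := Module.Free.ChooseBasisIndex k (S →ₗ[A] M)
  let Φ : (B →₀ S) →ₗ[k] S ⊗[k] (S →ₗ[A] M) := Finsupp.lsum ℕ fun β => (TensorProduct.mk k S (S →ₗ[A] M)).flip (b β)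
  have hΦ : ∀ t : B →₀ S, Φ t = t.sum fun β x => x ⊗ₜ[k] b β := fun t => by
    simp only [Φ, Finsupp.lsum_apply]
    rfl
  have hΦsurj : Function.Surjective Φ := by
    rw [← LinearMap.range_eq_top, eq_top_iff, ← TensorProduct.span_tmul_eq_top, Submodule.span_le]
    rintro _ ⟨s, f, rfl⟩
    -- `s ⊗ f = ∑_β (b.repr f β • s) ⊗ b β = Φ (…)`
    refine ⟨(b.repr f).mapRange (fun a => a • s) (by simp), ?_⟩
    rw [hΦ, Finsupp.sum_mapRange_index (fun _ => by simp)]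
    conv_rhs => rw [← b.linearCombination_repr f, Finsupp.linearCombination_apply, Finsupp.sum,
      TensorProduct.tmul_sum]
    rw [Finsupp.sum]
    exact Finset.sum_congr rfl fun β _ => by rw [TensorProduct.tmul_smul, TensorProduct.smul_tmul']
  rw [← LinearMap.ker_eq_bot, LinearMap.ker_eq_bot']
  intro x hx
  obtain ⟨t, rfl⟩ := hΦsurj x
  have hev' : ev (Φ t) = t.sum fun β y => b β y := by
    rw [hΦ, Finsupp.sum, map_sum, Finsupp.sum]
    exact Finset.sum_congr rfl fun β _ => hev _ _
  rw [hev'] at hx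
  rw [sum_eq_zero_of_linearIndependent (k := k) hS b.linearIndependent t hx, map_zero]

omit [IsScalarTower k A S] in
/-- **The evaluation map is onto an `S`-isotypic module**: if `M` is its own `S`-isotypic component (a sum of copies of
the simple module `S`), every `ev : S ⊗_k Hom_A(S, M) → M` with `ev (s ⊗ f) = f s` is surjective. (Bump 1997, proof of
Prop. 3.4.1, surjectivity of `λ`.) [cite: Bump1997, Prop. 3.4.1] -/
theorem surjective_of_forall_apply_tmul [IsSimpleModule A S] (hM : isotypicComponent A M S = ⊤)
    (ev : S ⊗[k] (S →ₗ[A] M) →ₗ[k] M) (hev : ∀ (s : S) (f : S →ₗ[A] M), ev (s ⊗ₜ[k] f) = f s) :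
    Function.Surjective ev := by
  -- the range of `ev` is an `A`-submodule (as `a • f s = f (a • s)`), containing every submodule isomorphic to `S`
  let R : Submodule A M :=
    { carrier := LinearMap.range ev
      add_mem' := fun ha hb => (LinearMap.range ev).add_mem ha hb
      zero_mem' := (LinearMap.range ev).zero_mem
      smul_mem' := by
        rintro a _ ⟨x, rfl⟩
        change a • ev x ∈ LinearMap.range ev
        induction x using TensorProduct.induction_on with
        | zero => rw [map_zero, smul_zero]; exact zero_mem _
        | tmul s f => exact ⟨(a • s) ⊗ₜ f, by rw [hev, hev, map_smul]⟩
        | add x y hx hy => rw [map_add, smul_add]; exact add_mem hx hy }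
  have hR : R = ⊤ := by
    rw [eq_top_iff, ← hM, isotypicComponent]
    refine sSup_le fun m ⟨e⟩ => fun x hx => ?_
    refine ⟨e ⟨x, hx⟩ ⊗ₜ (m.subtype.comp e.symm.toLinearMap), ?_⟩
    rw [hev]
    simp
  intro y
  have hy : y ∈ R := by rw [hR]; trivial
  exact hy

/-- **Isotypic calculus `M ≅ S ⊗_k Hom_A(S, M)`.**  For a simple `A`-module `S` with scalar commutant and an `A`-module
`M` that is the sum of its submodules isomorphic to `S`, there is a `k`-linear equivalence
`e : S ⊗_k Hom_A(S, M) ≃ M` with `e (s ⊗ f) = f s`. (Bourbaki VIII §4 n°4; Bump 1997, Prop. 3.4.1–3.4.2; Flath 1979,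
proof of Thm. 1.) [cite: Bump1997, Prop. 3.4.1] -/
theorem exists_linearEquiv_apply_tmul [IsSimpleModule A S]
    (hS : ∀ φ : S →ₗ[A] S, ∃ c : k, ∀ x, φ x = c • x) (hM : isotypicComponent A M S = ⊤) :
    ∃ e : S ⊗[k] (S →ₗ[A] M) ≃ₗ[k] M, ∀ (s : S) (f : S →ₗ[A] M), e (s ⊗ₜ[k] f) = f s := by
  let bil : S →ₗ[k] (S →ₗ[A] M) →ₗ[k] M :=
    LinearMap.mk₂ k (fun s f => f s) (fun s s' f => map_add f s s') (fun c s f => LinearMap.map_smul_of_tower f c s)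
      (fun s f f' => rfl) (fun c s f => rfl)
  let ev : S ⊗[k] (S →ₗ[A] M) →ₗ[k] M := TensorProduct.lift bil
  have hev : ∀ (s : S) (f : S →ₗ[A] M), ev (s ⊗ₜ[k] f) = f s := fun s f => by
    simp [ev, bil]
  exact ⟨LinearEquiv.ofBijective ev
      ⟨injective_of_forall_apply_tmul hS ev hev, surjective_of_forall_apply_tmul hM ev hev⟩,
    fun s f => by rw [LinearEquiv.ofBijective_apply, hev]⟩

end Module

/-! ## §2 The dictionary for representations of a group (`Hom_G(τ, π)` = `τ.IntertwiningMap π`) -/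

section Representation

open scoped MonoidAlgebra

variable {k : Type*} [Field k] {G : Type*} [Group G]
variable {T W : Type*} [AddCommGroup T] [Module k T] [AddCommGroup W] [Module k W]
variable (τ : Representation k G T) (π : Representation k G W)

/-- Scalar commutant: from intertwining self-maps of `τ` to `k[G]`-linear endomorphisms of `τ.asModule`. [folklore] -/
private theorem forall_asModule_end_exists_eq_smul (hτ : ∀ φ : τ.IntertwiningMap τ, ∃ c : k, ∀ x, φ x = c • x)
    (φ : τ.asModule →ₗ[k[G]] τ.asModule) : ∃ c : k, ∀ x, φ x = c • x := by
  obtain ⟨c, hc⟩ := hτ ((Representation.IntertwiningMap.equivLinearMapAsModule τ τ).symm φ)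
  exact ⟨c, fun x => hc x⟩

/-- **Linear disjointness of `τ` and `Hom_G(τ, π)`** for an irreducible `τ` with scalar commutant: a `k`-linearly
independent family of intertwiners `(f_β)` and a finitely supported `(t_β)` with `∑_β f_β t_β = 0` force every `t_β = 0`.
[cite: Bump1997, Prop. 3.4.1] -/
theorem intertwiningMap_sum_eq_zero_of_linearIndependent [τ.IsIrreducible]
    (hτ : ∀ φ : τ.IntertwiningMap τ, ∃ c : k, ∀ x, φ x = c • x)
    {B : Type*} {f : B → τ.IntertwiningMap π} (hf : LinearIndependent k f)
    (t : B →₀ T) (ht : (t.sum fun β x => f β x) = 0) : t = 0 := by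
  let E := Representation.IntertwiningMap.equivLinearMapAsModule τ π
  have hf' : LinearIndependent k (fun β => E (f β)) := hf.map' E.toLinearMap E.ker
  exact sum_eq_zero_of_linearIndependent (k := k) (A := k[G]) (S := τ.asModule) (M := π.asModule)
    (forall_asModule_end_exists_eq_smul τ hτ) hf' t ht

/-- **The evaluation map `T ⊗_k Hom_G(τ, π) → W` is injective** for an irreducible `τ` with scalar commutant and ANY
`π` (every `k`-linear `ev` with `ev (t ⊗ f) = f t`). [cite: Bump1997, Prop. 3.4.1] -/
theorem intertwiningMap_injective_of_forall_apply_tmul [τ.IsIrreducible]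
    (hτ : ∀ φ : τ.IntertwiningMap τ, ∃ c : k, ∀ x, φ x = c • x)
    (ev : T ⊗[k] τ.IntertwiningMap π →ₗ[k] W) (hev : ∀ (t : T) (f : τ.IntertwiningMap π), ev (t ⊗ₜ[k] f) = f t) :
    Function.Injective ev := by
  let E := Representation.IntertwiningMap.equivLinearMapAsModule τ π
  let C : T ⊗[k] (τ.asModule →ₗ[k[G]] π.asModule) ≃ₗ[k] T ⊗[k] τ.IntertwiningMap π :=
    TensorProduct.congr (LinearEquiv.refl k T) E.symm
  let ev' : τ.asModule ⊗[k] (τ.asModule →ₗ[k[G]] π.asModule) →ₗ[k] π.asModule := ev ∘ₗ C.toLinearMap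
  have hev' : ∀ (s : τ.asModule) (f : τ.asModule →ₗ[k[G]] π.asModule), ev' (s ⊗ₜ[k] f) = f s := fun s f => by
    change ev (C (s ⊗ₜ[k] f)) = f s
    rw [TensorProduct.congr_tmul, hev]
    rfl
  have h := injective_of_forall_apply_tmul (k := k) (A := k[G]) (S := τ.asModule) (M := π.asModule)
    (forall_asModule_end_exists_eq_smul τ hτ) ev' hev'
  exact (Function.Injective.of_comp_iff' ev C.bijective).1 h

/-- **The evaluation map is onto a `τ`-isotypic `π`**: if the `k[G]`-module of `π` is its own `τ`-isotypic component
(`π` is a sum of copies of the irreducible `τ`), every `ev` with `ev (t ⊗ f) = f t` is surjective.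
[cite: Bump1997, Prop. 3.4.1] -/
theorem intertwiningMap_surjective_of_forall_apply_tmul [τ.IsIrreducible]
    (hπ : isotypicComponent k[G] π.asModule τ.asModule = ⊤)
    (ev : T ⊗[k] τ.IntertwiningMap π →ₗ[k] W) (hev : ∀ (t : T) (f : τ.IntertwiningMap π), ev (t ⊗ₜ[k] f) = f t) :
    Function.Surjective ev := by
  let E := Representation.IntertwiningMap.equivLinearMapAsModule τ π
  let C : T ⊗[k] (τ.asModule →ₗ[k[G]] π.asModule) ≃ₗ[k] T ⊗[k] τ.IntertwiningMap π :=
    TensorProduct.congr (LinearEquiv.refl k T) E.symm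
  let ev' : τ.asModule ⊗[k] (τ.asModule →ₗ[k[G]] π.asModule) →ₗ[k] π.asModule := ev ∘ₗ C.toLinearMap
  have hev' : ∀ (s : τ.asModule) (f : τ.asModule →ₗ[k[G]] π.asModule), ev' (s ⊗ₜ[k] f) = f s := fun s f => by
    change ev (C (s ⊗ₜ[k] f)) = f s
    rw [TensorProduct.congr_tmul, hev]
    rfl
  have h := surjective_of_forall_apply_tmul (k := k) (A := k[G]) (S := τ.asModule) (M := π.asModule) hπ ev' hev'
  exact Function.Surjective.of_comp h

/-- **Isotypic calculus `π ≅ τ ⊗_k Hom_G(τ, π)` for representations.**  For an irreducible `τ : G → GL(T)` with scalar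
commutant and a representation `π : G → GL(W)` that is the sum of its subrepresentations isomorphic to `τ`, there is a
`k`-linear equivalence `e : T ⊗_k Hom_G(τ, π) ≃ W` with `e (t ⊗ f) = f t` (hence `e ∘ (τ g ⊗ 1) = π g ∘ e`, and `e`
intertwines `1 ⊗ (u ∘ ·)` with `u` for every `u` commuting with `π(G)`). (Bump 1997, Prop. 3.4.1–3.4.2; Flath 1979, Thm. 1.)
[cite: Bump1997, Prop. 3.4.1] -/
theorem intertwiningMap_exists_linearEquiv_apply_tmul [τ.IsIrreducible]
    (hτ : ∀ φ : τ.IntertwiningMap τ, ∃ c : k, ∀ x, φ x = c • x)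
    (hπ : isotypicComponent k[G] π.asModule τ.asModule = ⊤) :
    ∃ e : T ⊗[k] τ.IntertwiningMap π ≃ₗ[k] W, ∀ (t : T) (f : τ.IntertwiningMap π), e (t ⊗ₜ[k] f) = f t := by
  let bil : T →ₗ[k] τ.IntertwiningMap π →ₗ[k] W :=
    LinearMap.mk₂ k (fun t f => f t) (fun t t' f => map_add f t t') (fun c t f => map_smul f c t)
      (fun t f f' => rfl) (fun c t f => rfl)
  let ev : T ⊗[k] τ.IntertwiningMap π →ₗ[k] W := TensorProduct.lift bil
  have hev : ∀ (t : T) (f : τ.IntertwiningMap π), ev (t ⊗ₜ[k] f) = f t := fun t f => by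
    simp [ev, bil]
  exact ⟨LinearEquiv.ofBijective ev ⟨intertwiningMap_injective_of_forall_apply_tmul τ π hτ ev hev,
      intertwiningMap_surjective_of_forall_apply_tmul τ π hπ ev hev⟩,
    fun t f => by rw [LinearEquiv.ofBijective_apply, hev]⟩

end Representation

/-! ## §3 Fixed tensors: `(V ⊗ M)` fixed under `f ⊗ 1` (`f ∈ F`) comes from `V^F ⊗ M` (over a field) -/

section FixedTensors

variable {k : Type*} [Field k] {V M : Type*} [AddCommGroup V] [Module k V] [AddCommGroup M] [Module k M]

/-- **Fixed tensors come from fixed vectors (left factor).**  Over a field: if `P ≤ V` is the joint fixed space of a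
set `F` of endomorphisms of `V`, every `x ∈ V ⊗ M` with `(f ⊗ 1) x = x` for all `f ∈ F` lies in the image of `P ⊗ M`
(expand `x` along a basis of `M`) — the linear algebra behind «the `K`-fixed vectors of `⊗ V_v` are `⊗ V_v^{K_v}`»
(Flath 1979, §2 Example 2; Bump 1997, proof of Thm. 3.4.4 ∕ Prop. 3.4.9). [cite: FlathCorvallis1979, §2 Example 2] -/
theorem mem_range_rTensor_subtype_of_forall_rTensor_eq (P : Submodule k V) (F : Set (V →ₗ[k] V))
    (hP : ∀ v, (∀ f ∈ F, f v = v) → v ∈ P) (x : V ⊗[k] M) (hx : ∀ f ∈ F, f.rTensor M x = x) :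
    x ∈ LinearMap.range (P.subtype.rTensor M) := by
  classical
  let b := Module.Free.chooseBasis k M
  let B := Module.Free.ChooseBasisIndex k M
  let e : V ⊗[k] M ≃ₗ[k] (B →₀ V) :=
    (TensorProduct.congr (LinearEquiv.refl k V) b.repr).trans (TensorProduct.finsuppScalarRight k k V B)
  -- `e` transports `f ⊗ 1` to `mapRange f`
  have he : ∀ (f : V →ₗ[k] V) (y : V ⊗[k] M) (β : B), e (f.rTensor M y) β = f (e y β) := by
    intro f y β
    induction y using TensorProduct.induction_on with
    | zero => simp
    | tmul v m =>
      simp only [e, LinearMap.rTensor_tmul, LinearEquiv.trans_apply, TensorProduct.congr_tmul,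
        LinearEquiv.refl_apply, TensorProduct.finsuppScalarRight_apply_tmul_apply, map_smul]
    | add y z hy hz => simp only [map_add, Finsupp.add_apply, hy, hz]
  -- each coordinate of `e x` is fixed by `F`, hence lies in `P`
  have hcoord : ∀ β, e x β ∈ P := fun β => hP _ fun f hf => by rw [← he f x β, hx f hf]
  -- `x = ∑_β (e x β) ⊗ b β`
  have hx' : x = (e x).sum fun β v => v ⊗ₜ[k] b β := by
    apply e.injective
    conv_lhs => rw [← Finsupp.sum_single (e x)]
    rw [map_finsuppSum]
    refine Finset.sum_congr rfl fun β _ => ?_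
    simp only [e, LinearEquiv.trans_apply, TensorProduct.congr_tmul, LinearEquiv.refl_apply,
      Module.Basis.repr_self, TensorProduct.finsuppScalarRight_apply_tmul, Finsupp.sum_single_index,
      zero_smul, Finsupp.single_zero, one_smul]
  rw [hx']
  refine Submodule.finsuppSum_mem _ _ _ _ fun β _ => ?_
  exact ⟨⟨e x β, hcoord β⟩ ⊗ₜ[k] b β, by simp⟩

/-- **Fixed tensors come from fixed vectors (right factor)** — the mirror statement for `1 ⊗ g`, `g ∈ F` (Flath 1979, §2
Example 2). [cite: FlathCorvallis1979, §2 Example 2] -/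
theorem mem_range_lTensor_subtype_of_forall_lTensor_eq (Q : Submodule k M) (F : Set (M →ₗ[k] M))
    (hQ : ∀ m, (∀ g ∈ F, g m = m) → m ∈ Q) (x : V ⊗[k] M) (hx : ∀ g ∈ F, g.lTensor V x = x) :
    x ∈ LinearMap.range (Q.subtype.lTensor V) := by
  -- transport along `comm : V ⊗ M ≃ M ⊗ V`
  have hx1 : ∀ g ∈ F, g.rTensor V ((TensorProduct.comm k V M).toLinearMap x) =
      (TensorProduct.comm k V M).toLinearMap x := fun g hg => by
    rw [← LinearMap.comp_apply, LinearMap.rTensor_comp_comm, LinearMap.comp_apply, hx g hg]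
  obtain ⟨y, hy⟩ := mem_range_rTensor_subtype_of_forall_rTensor_eq (M := V) Q F hQ _ hx1
  refine ⟨TensorProduct.comm k Q V y, ?_⟩
  have h2 : Q.subtype.lTensor V (TensorProduct.comm k Q V y) =
      TensorProduct.comm k M V (Q.subtype.rTensor V y) := by
    rw [← LinearEquiv.coe_toLinearMap (TensorProduct.comm k Q V), ← LinearMap.comp_apply,
      LinearMap.lTensor_comp_comm, LinearMap.comp_apply, LinearEquiv.coe_toLinearMap]
  have h3 : ∀ z : V ⊗[k] M, TensorProduct.comm k M V ((TensorProduct.comm k V M).toLinearMap z) = z := fun z => by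
    induction z using TensorProduct.induction_on with
    | zero => simp
    | tmul v m => simp
    | add a b ha hb => simp only [map_add, ha, hb]
  rw [h2, hy, h3]

/-- **Fixed tensors under `F ⊗ 1` and `1 ⊗ F'` come from `V^F ⊗ M^{F'}`** (over a field): with `P`, `Q` the joint fixed
spaces of `F ⊆ End V` and `F' ⊆ End M`, every `x ∈ V ⊗ M` fixed by all `f ⊗ 1` and all `1 ⊗ g` lies in the image of
`P ⊗ Q → V ⊗ M`, which is injective; so the fixed tensors are `≅ P ⊗ Q` and have dimension `dim P · dim Q` in the
finite-dimensional case — the invariants of an outer tensor product of representations of two groups (Flath 1979, §2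
Example 2: `(⊗ V_v)^{∏ K_v} = ⊗ V_v^{K_v}`). [cite: FlathCorvallis1979, §2 Example 2] -/
theorem mem_range_mapIncl_of_forall_eq (P : Submodule k V) (Q : Submodule k M) (F : Set (V →ₗ[k] V))
    (F' : Set (M →ₗ[k] M)) (hP : ∀ v, (∀ f ∈ F, f v = v) → v ∈ P) (hQ : ∀ m, (∀ g ∈ F', g m = m) → m ∈ Q)
    (x : V ⊗[k] M) (hx : ∀ f ∈ F, f.rTensor M x = x) (hx' : ∀ g ∈ F', g.lTensor V x = x) :
    x ∈ LinearMap.range (TensorProduct.mapIncl P Q) := by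
  obtain ⟨y, rfl⟩ := mem_range_rTensor_subtype_of_forall_rTensor_eq P F hP x hx
  -- `y ∈ P ⊗ M` is fixed by `1 ⊗ g`: `P ⊗ M → V ⊗ M` is injective and commutes with `1 ⊗ g`
  have hinj : Function.Injective (P.subtype.rTensor M) :=
    Module.Flat.rTensor_preserves_injective_linearMap _ P.subtype_injective
  have hy : ∀ g ∈ F', g.lTensor P y = y := fun g hg => hinj (by
    rw [← LinearMap.comp_apply, LinearMap.rTensor_comp_lTensor, ← LinearMap.lTensor_comp_rTensor,
      LinearMap.comp_apply, hx' g hg])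
  obtain ⟨z, rfl⟩ := mem_range_lTensor_subtype_of_forall_lTensor_eq (V := P) Q F' hQ y hy
  exact ⟨z, by rw [TensorProduct.mapIncl, ← LinearMap.rTensor_comp_lTensor, LinearMap.comp_apply]⟩

end FixedTensors

end Literature.RepresentationTheory

end
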